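import Summits.CriticalPhenomena.CardyFormulaZ2.Theorems.CardyComplexConeEdgePrecompactUFRSHalfPlaneArms

/-!
# Three strands of one completion ⇒ half-plane arms, V: trimming and lattice frames
(line `qkz-strip-boundary-arm` of crux `CardyComplexCone.EdgePrecompact`, stmt-CriticalPhenomena-11387;
the framing step of the registered sub-goal `ufrs_rect_strandsHpArms_pure`, HT-A pure case)

The combinatorial core `rect_threeArms` (`…UFRSStrandsHpArmsPureArms.lean`) produces three genuine
arms of `ω` in the ORIGINAL lattice coordinates: starts within `r + 4` of `z`, ends beyond
`R - 4`, open arms through box sites, dual arms through inner faces. The target event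
`hpLooseArms j 3 m R'` (`…UFRSHalfPlaneArms.lean`) lives in the upright half-plane and is evaluated
on the relabelled configuration `relabel φ ω` of a lattice frame `φ`. This file bridges the two:

* `ufrs_hpLooseArmsOfArms` (registered anchor): in standard position —
  starts in the window box, ends `Far`, open arms at height `≥ 0`, dual arms at height `≥ -1` —
  trimming every arm at its first `Far` vertex (`exists_prefix_exit`) puts it in `siteBox` /
  `faceBox` and gives membership in `hpLooseArms`;
* `transport_arms_HTP`: arms of `ω` are carried to arms of `relabel φ ω` by a pair of lattice
  automorphisms, `φ` on sites and `ψ` on faces (lower-left corners), provided `ψ` maps the edge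
  separating two adjacent faces to the `φ`-image of the separating edge (for orientation-reversing
  `φ` the face map is `φ` shifted by one unit);
* `frame_hpLooseArms_HTP`: the two combined under an abstract FRAME SPECIFICATION (coordinates of
  `φ` are signed coordinate functions, `ψ` is `φ` up to a unit shift of the height, box sites and
  inner faces have nonnegative height, a base site `p₀` near `z` is sent to `(j, 0)`); the four
  side frames of a rectangle are instances (`…UFRSStrandsHpArmsPure.lean`).

References: G. F. Lawler, O. Schramm, W. Werner, Electron. J. Probab. 7 (2002), Appendix A;
G. Grimmett, *Percolation* (1999), §1.6 (lattice symmetries), §11.2 (planar duality).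
-/

namespace Summit.CriticalPhenomena.CardyFormulaZ2.Cruxes.EdgePrecompact.QkzStripBoundaryArm

open MeasureTheory Filter Set Metric Complex
open scoped Topology BigOperators Pointwise
open Literature.Probability.LatticeModels Literature.Probability.Percolation
open Literature.Probability.RandomPlanarGeometry (DobrushinDomain)
open Summit.CriticalPhenomena.CardyFormulaZ2.Theses.CardyComplexCone

noncomputable section

/-! ## Trimming in standard position -/

/-- Darts of a walk whose edges lie among the edges of another walk cross the same primal edges. -/
theorem darts_sepEdge_of_edges_HTP {x y x' y' : Site 2} (W : (zdGraph 2).Walk x y) (W' : (zdGraph 2).Walk x' y')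
    (h : ∀ e ∈ W'.edges, e ∈ W.edges) :
    ∀ d ∈ W'.darts, ∃ d₀ ∈ W.darts, sepEdge d.fst d.snd = sepEdge d₀.fst d₀.snd := by
  intro d hd
  have he : s(d.fst, d.snd) ∈ W.edges := h _ (by
    rw [SimpleGraph.Walk.edges, List.mem_map]; exact ⟨d, hd, rfl⟩)
  rw [SimpleGraph.Walk.edges, List.mem_map] at he
  obtain ⟨d₀, hd₀, he⟩ := he
  refine ⟨d₀, hd₀, ?_⟩
  change s(d₀.fst, d₀.snd) = s(d.fst, d.snd) at he
  rcases Sym2.eq_iff.1 he with ⟨h1, h2⟩ | ⟨h1, h2⟩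
  · rw [h1, h2]
  · rw [← h1, ← h2, sepEdge_comm]

/-- **Trimming an arm at its first far vertex.** A walk from a non-`Far` site to a `Far` site has
an initial segment ending at its first `Far` site, all of whose other sites are not `Far`, whose
sites and edges are among those of the walk, whose darts cross the same edges as darts of the walk,
and whose last site is adjacent to a non-`Far` site. -/
theorem exists_trim_far_HTP {R : ℕ} {j : ℤ} {x y : Site 2} (W : (zdGraph 2).Walk x y)
    (hx : ¬ Z2HalfPlane.Far R j x) (hy : Z2HalfPlane.Far R j y) :
    ∃ (y' : Site 2) (W' : (zdGraph 2).Walk x y'), Z2HalfPlane.Far R j y' ∧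
      (∀ u ∈ W'.support, u ∈ W.support) ∧ (∀ e ∈ W'.edges, e ∈ W.edges) ∧
      (∀ d ∈ W'.darts, ∃ d₀ ∈ W.darts, sepEdge d.fst d.snd = sepEdge d₀.fst d₀.snd) ∧
      (∀ u ∈ W'.support, ¬ Z2HalfPlane.Far R j u ∨ ∃ v, ¬ Z2HalfPlane.Far R j v ∧ (zdGraph 2).Adj v u) := by
  obtain ⟨x', z', q₁, hadj, hz', hA, hsupp, hE, hlast⟩ :=
    exists_prefix_exit (A := {u | ¬ Z2HalfPlane.Far R j u}) W hx (fun h => h hy)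
  have hE' : ∀ e ∈ (q₁.concat hadj).edges, e ∈ W.edges := by
    intro e he
    rw [SimpleGraph.Walk.edges_concat, List.concat_eq_append, List.mem_append, List.mem_singleton] at he
    rcases he with he | rfl
    · exact hE e he
    · exact hlast
  refine ⟨z', q₁.concat hadj, not_not.1 hz', fun u hu => ?_, hE', darts_sepEdge_of_edges_HTP W _ hE', fun u hu => ?_⟩
  · rw [SimpleGraph.Walk.support_concat, List.mem_append, List.mem_singleton] at hu
    rcases hu with hu | rfl
    · exact hsupp u hu
    · exact SimpleGraph.Walk.snd_mem_support_of_mem_edges _ hlast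
  · rw [SimpleGraph.Walk.support_concat, List.mem_append, List.mem_singleton] at hu
    rcases hu with hu | rfl
    · exact Or.inl (hA u hu)
    · exact Or.inr ⟨x', hA x' q₁.end_mem_support, hadj⟩

/-- Coordinates of lattice neighbours differ by at most one. -/
theorem coord_adj_HTP {u v : Site 2} (h : (zdGraph 2).Adj u v) : |u 0 - v 0| ≤ 1 ∧ |u 1 - v 1| ≤ 1 := by
  rw [zdGraph_adj_iff] at h
  obtain ⟨i, hi⟩ := h
  have hc : ∀ k, |u k - v k| ≤ 1 := by
    intro k
    rcases hi with h | h <;> rw [h] <;> by_cases hk : k = i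
    · subst hk; simp
    · simp [Pi.single_eq_of_ne hk]
    · subst hk; simp
    · simp [Pi.single_eq_of_ne hk]
  exact ⟨hc 0, hc 1⟩

/-- **Loose arms from arms in standard position** (registered anchor `ufrs_hpLooseArmsOfArms` of
stmt-CriticalPhenomena-11387). Three walks of two colours, started in the window box
`[j-m, j+m] × (·, m]` with `m < R`, ended at `Far` sites, open ones along `ω`-open edges through
sites of nonnegative height, dual ones crossing `ω`-closed edges through faces of height `≥ -1`,
same-colour arms edge- / crossing-disjoint, give `ω ∈ hpLooseArms j 3 m R` (trim each arm at its
first `Far` site). -/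
theorem ufrs_hpLooseArmsOfArms : ∀ (ω : BondConfig (Site 2)) (j : ℤ) (m R : ℕ), m < R → ∀ (κ : Fin 3 → Bool) (x y : Fin 3 → Site 2) (W : ∀ a, (zdGraph 2).Walk (x a) (y a)), (∃ a b, κ a ≠ κ b) → (∀ a, (j - m ≤ x a 0 ∧ x a 0 ≤ j + m ∧ x a 1 ≤ m) ∧ Z2HalfPlane.Far R j (y a) ∧ (κ a = true → (∀ u ∈ (W a).support, 0 ≤ u 1) ∧ ∀ e ∈ (W a).edges, e ∈ ω) ∧ (κ a = false → (∀ u ∈ (W a).support, -1 ≤ u 1) ∧ ∀ d ∈ (W a).darts, sepEdge d.fst d.snd ∉ ω)) → Pairwise (fun a b => κ a = κ b → (κ a = true → ∀ e ∈ (W a).edges, e ∉ (W b).edges) ∧ (κ a = false → ∀ d ∈ (W a).darts, ∀ d' ∈ (W b).darts, sepEdge d.fst d.snd ≠ sepEdge d'.fst d'.snd)) → ω ∈ hpLooseArms j 3 m R := by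
  intro ω j m R hmR κ x y W hne harm hpw
  have hxfar : ∀ a, ¬ Z2HalfPlane.Far R j (x a) := by
    intro a h
    obtain ⟨⟨h1, h2, h3⟩, -⟩ := harm a
    have : (m : ℤ) < R := by exact_mod_cast hmR
    rcases h with h | h
    · have := abs_le.2 (show -(m : ℤ) ≤ x a 0 - j ∧ x a 0 - j ≤ m by omega); omega
    · omega
  choose y' W' hfar hsupp hE hD hbox using fun a => exists_trim_far_HTP (W a) (hxfar a) (harm a).2.1
  -- coordinates of the trimmed arms
  have hcoord : ∀ a, ∀ u ∈ (W' a).support, |u 0 - j| ≤ R ∧ u 1 ≤ R := by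
    intro a u hu
    rcases hbox a u hu with h | ⟨v, hv, hvu⟩
    · simp only [Z2HalfPlane.Far, not_or, not_le] at h; omega
    · simp only [Z2HalfPlane.Far, not_or, not_le] at hv
      obtain ⟨h0, h1⟩ := coord_adj_HTP hvu
      have := abs_le.1 h0; have := abs_le.1 h1
      have := abs_lt.1 hv.1
      constructor
      · exact abs_le.2 ⟨by omega, by omega⟩
      · omega
  rw [mem_hpLooseArms_iff]
  refine ⟨κ, x, y', W', hne, fun a => ⟨(harm a).1, hfar a, fun hκ => ⟨fun u hu => ?_, fun e he => ?_⟩,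
    fun hκ => ⟨fun u hu => ?_, fun d hd => ?_⟩⟩, fun a b hab hκ => ⟨fun hκa e hea heb => ?_, fun hκa d hd d' hd' => ?_⟩⟩
  · obtain ⟨h1, h2⟩ := hcoord a u hu
    have h3 := ((harm a).2.2.1 hκ).1 u (hsupp a u hu)
    have := abs_le.1 h1
    exact Z2HalfPlane.mem_siteBox.2 ⟨⟨by omega, by omega⟩, h3, h2⟩
  · exact ((harm a).2.2.1 hκ).2 e (hE a e he)
  · obtain ⟨h1, h2⟩ := hcoord a u hu
    have h3 := ((harm a).2.2.2 hκ).1 u (hsupp a u hu)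
    have := abs_le.1 h1
    exact Z2HalfPlane.mem_faceBox.2 ⟨⟨by omega, by omega⟩, h3, h2⟩
  · obtain ⟨d₀, hd₀, he⟩ := hD a d hd
    rw [he]; exact ((harm a).2.2.2 hκ).2 d₀ hd₀
  · exact ((hpw hab hκ).1 hκa) e (hE a e hea) (hE b e heb)
  · obtain ⟨d₀, hd₀, he⟩ := hD a d hd
    obtain ⟨d₀', hd₀', he'⟩ := hD b d' hd'
    rw [he, he']; exact ((hpw hab hκ).2 hκa) d₀ hd₀ d₀' hd₀'

/-! ## Transport of arms under a lattice frame -/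

/-- **Transport of three arms under a frame.** `φ` acts on sites, `ψ` on faces; `ψ` maps adjacent
faces to adjacent faces and their separating edge to the `φ`-image of the separating edge. Arms
of `ω` (open along `ω`-open edges, dual across `ω`-closed edges, same-colour disjointness) become
arms of `relabel φ ω` with `φ`-mapped open walks and `ψ`-mapped dual walks. -/
theorem transport_arms_HTP (φ ψ : zdGraph 2 ≃g zdGraph 2)
    (hψ : ∀ g g' : Site 2, (zdGraph 2).Adj g g' → sepEdge (ψ g) (ψ g') = Sym2.map φ (sepEdge g g'))
    (ω : BondConfig (Site 2)) (κ : Fin 3 → Bool) (x y : Fin 3 → Site 2) (W : ∀ a, (zdGraph 2).Walk (x a) (y a))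
    (harm : ∀ a, (κ a = true → ∀ e ∈ (W a).edges, e ∈ ω) ∧ (κ a = false → ∀ d ∈ (W a).darts, sepEdge d.fst d.snd ∉ ω))
    (hpw : Pairwise (fun a b => κ a = κ b → (κ a = true → ∀ e ∈ (W a).edges, e ∉ (W b).edges) ∧
      (κ a = false → ∀ d ∈ (W a).darts, ∀ d' ∈ (W b).darts, sepEdge d.fst d.snd ≠ sepEdge d'.fst d'.snd))) :
    ∃ (x' y' : Fin 3 → Site 2) (W' : ∀ a, (zdGraph 2).Walk (x' a) (y' a)),
      (∀ a, (κ a = true → x' a = φ (x a) ∧ y' a = φ (y a) ∧ (∀ u ∈ (W' a).support, ∃ v ∈ (W a).support, u = φ v) ∧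
          ∀ e ∈ (W' a).edges, e ∈ BondConfig.relabel (sym2Equiv φ.toEquiv) ω) ∧
        (κ a = false → x' a = ψ (x a) ∧ y' a = ψ (y a) ∧ (∀ u ∈ (W' a).support, ∃ g ∈ (W a).support, u = ψ g) ∧
          ∀ d ∈ (W' a).darts, sepEdge d.fst d.snd ∉ BondConfig.relabel (sym2Equiv φ.toEquiv) ω)) ∧
      Pairwise (fun a b => κ a = κ b → (κ a = true → ∀ e ∈ (W' a).edges, e ∉ (W' b).edges) ∧
        (κ a = false → ∀ d ∈ (W' a).darts, ∀ d' ∈ (W' b).darts, sepEdge d.fst d.snd ≠ sepEdge d'.fst d'.snd)) := by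
  classical
  set fφ : zdGraph 2 →g zdGraph 2 := φ.toEmbedding.toHom with hfφ
  set fψ : zdGraph 2 →g zdGraph 2 := ψ.toEmbedding.toHom with hfψ
  have hfφa : ∀ v, fφ v = φ v := fun v => rfl
  have hfψa : ∀ v, fψ v = ψ v := fun v => rfl
  have hinj : Function.Injective (Sym2.map φ) := Sym2.map.injective φ.injective
  have hmemrel : ∀ e, Sym2.map φ e ∈ BondConfig.relabel (sym2Equiv φ.toEquiv) ω ↔ e ∈ ω := fun e => by
    rw [BondConfig.relabel_apply]; exact hinj.mem_set_image
  -- the mapped arms, as a sigma type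
  obtain ⟨arm, harm_t, harm_f⟩ : ∃ arm : Fin 3 → Σ u v : Site 2, (zdGraph 2).Walk u v,
      (∀ a, κ a = true → arm a = ⟨φ (x a), φ (y a), (W a).map fφ⟩) ∧
      (∀ a, κ a = false → arm a = ⟨ψ (x a), ψ (y a), (W a).map fψ⟩) :=
    ⟨fun a => if κ a = true then ⟨φ (x a), φ (y a), (W a).map fφ⟩ else ⟨ψ (x a), ψ (y a), (W a).map fψ⟩,
      fun a h => if_pos h, fun a h => if_neg (by simp [h])⟩
  -- edges / darts of the mapped walks
  have hedges_t : ∀ a (h : κ a = true), ∀ e ∈ (arm a).2.2.edges, ∃ e₀ ∈ (W a).edges, e = Sym2.map φ e₀ := by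
    intro a h e he
    rw [harm_t a h] at he
    dsimp only at he
    rw [SimpleGraph.Walk.edges_map, List.mem_map] at he
    obtain ⟨e₀, he₀, rfl⟩ := he
    exact ⟨e₀, he₀, rfl⟩
  have hdarts_f : ∀ a (h : κ a = false), ∀ d ∈ (arm a).2.2.darts, ∃ d₀ ∈ (W a).darts,
      sepEdge d.fst d.snd = Sym2.map φ (sepEdge d₀.fst d₀.snd) := by
    intro a h d hd
    rw [harm_f a h] at hd
    dsimp only at hd
    rw [SimpleGraph.Walk.darts_map, List.mem_map] at hd
    obtain ⟨d₀, hd₀, rfl⟩ := hd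
    exact ⟨d₀, hd₀, by rw [SimpleGraph.Hom.mapDart_apply]; exact hψ _ _ d₀.adj⟩
  refine ⟨fun a => (arm a).1, fun a => (arm a).2.1, fun a => (arm a).2.2, fun a => ⟨fun h => ?_, fun h => ?_⟩,
    fun a b hab hκ => ⟨fun h e hea heb => ?_, fun h d hd d' hd' heq => ?_⟩⟩
  · refine ⟨by dsimp only; rw [harm_t a h], by dsimp only; rw [harm_t a h], fun u hu => ?_, fun e he => ?_⟩
    · dsimp only at hu
      rw [harm_t a h] at hu
      dsimp only at hu
      rw [SimpleGraph.Walk.support_map, List.mem_map] at hu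
      obtain ⟨v, hv, rfl⟩ := hu
      exact ⟨v, hv, rfl⟩
    · obtain ⟨e₀, he₀, rfl⟩ := hedges_t a h e he
      exact (hmemrel e₀).2 ((harm a).1 h e₀ he₀)
  · refine ⟨by dsimp only; rw [harm_f a h], by dsimp only; rw [harm_f a h], fun u hu => ?_, fun d hd => ?_⟩
    · dsimp only at hu
      rw [harm_f a h] at hu
      dsimp only at hu
      rw [SimpleGraph.Walk.support_map, List.mem_map] at hu
      obtain ⟨v, hv, rfl⟩ := hu
      exact ⟨v, hv, rfl⟩
    · obtain ⟨d₀, hd₀, he⟩ := hdarts_f a h d hd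
      rw [he, hmemrel]
      exact (harm a).2 h d₀ hd₀
  · obtain ⟨e₁, he₁, rfl⟩ := hedges_t a h e hea
    obtain ⟨e₂, he₂, he12⟩ := hedges_t b (hκ ▸ h) _ heb
    rw [hinj he12] at he₁
    exact (hpw hab hκ).1 h e₂ he₁ he₂
  · obtain ⟨d₁, hd₁, he₁⟩ := hdarts_f a h d hd
    obtain ⟨d₂, hd₂, he₂⟩ := hdarts_f b (hκ ▸ h) d' hd'
    rw [he₁, he₂] at heq
    exact (hpw hab hκ).2 h d₁ hd₁ d₂ hd₂ (hinj heq)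

/-! ## The framing lemma -/

/-- Euclidean distance controls coordinate differences of lattice points. -/
theorem coord_le_dist_HTP (u v : Site 2) :
    (|u 0 - v 0| : ℝ) ≤ dist (Site.toComplex u) (Site.toComplex v) ∧ (|u 1 - v 1| : ℝ) ≤ dist (Site.toComplex u) (Site.toComplex v) := by
  rw [Complex.dist_eq]
  constructor
  · have h := abs_re_le_norm (Site.toComplex u - Site.toComplex v)
    simpa [Complex.sub_re] using h
  · have h := abs_im_le_norm (Site.toComplex u - Site.toComplex v)
    simpa [Complex.sub_im] using h

/-- The Euclidean distance of lattice points is at most the sum of the coordinate differences. -/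
theorem dist_le_coord_HTP (u v : Site 2) :
    dist (Site.toComplex u) (Site.toComplex v) ≤ (|u 0 - v 0| : ℝ) + |u 1 - v 1| := by
  rw [Complex.dist_eq]
  have h := Complex.norm_le_abs_re_add_abs_im (Site.toComplex u - Site.toComplex v)
  simpa [Complex.sub_re, Complex.sub_im] using h

/-- **Framing.** Three genuine arms of `ω` in original coordinates (starts within `r + 4` of `z`,
ends beyond `R₁ - 4`, open arms through `V`, dual arms through `In`-faces) and a frame `(φ, ψ)`:
`ψ` compatible with `φ` on separating edges; the coordinates of `φ u - φ v` are, in absolute value,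
the coordinates `k₀ ≠ k₁` of `u - v`; `ψ g` has the abscissa of `φ g` and its height or its height
minus one; `V`-sites and `In`-faces get nonnegative heights; a base site `p₀` within `r + 2` of `z`
is sent to `(j, 0)`. Then, for `2r + 7 ≤ m < R'` and `2R' + r + 8 ≤ R₁`, the relabelled
configuration has three loose arms: `relabel φ ω ∈ hpLooseArms j 3 m R'`. -/
theorem frame_hpLooseArms_HTP (φ ψ : zdGraph 2 ≃g zdGraph 2)
    (hψ : ∀ g g' : Site 2, (zdGraph 2).Adj g g' → sepEdge (ψ g) (ψ g') = Sym2.map φ (sepEdge g g'))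
    (k₀ k₁ : Fin 2) (hk : k₀ ≠ k₁) (hφ0 : ∀ u v : Site 2, |φ u 0 - φ v 0| = |u k₀ - v k₀|)
    (hφ1 : ∀ u v : Site 2, |φ u 1 - φ v 1| = |u k₁ - v k₁|)
    (hψφ : ∀ g : Site 2, ψ g 0 = φ g 0 ∧ (ψ g 1 = φ g 1 ∨ ψ g 1 = φ g 1 - 1))
    (V : Set (Site 2)) (In : Site 2 → Prop) (hVh : ∀ u ∈ V, 0 ≤ φ u 1) (hInh : ∀ g, In g → 0 ≤ ψ g 1)
    (z : ℂ) (r R₁ : ℝ) (j : ℤ) (p₀ : Site 2) (hp₀ : φ p₀ 0 = j ∧ φ p₀ 1 = 0) (hzp₀ : dist (Site.toComplex p₀) z ≤ r + 2)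
    (m R' : ℕ) (hm : 2 * r + 7 ≤ m) (hmR : m < R') (hR' : 2 * (R' : ℝ) + r + 8 ≤ R₁)
    (ω : BondConfig (Site 2)) (κ : Fin 3 → Bool) (x y : Fin 3 → Site 2) (W : ∀ a, (zdGraph 2).Walk (x a) (y a))
    (hne : ∃ a b, κ a ≠ κ b)
    (harm : ∀ a, dist (Site.toComplex (x a)) z ≤ r + 4 ∧ R₁ - 4 ≤ dist (Site.toComplex (y a)) z ∧
      (κ a = true → (∀ u ∈ (W a).support, u ∈ V) ∧ ∀ e ∈ (W a).edges, e ∈ ω) ∧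
      (κ a = false → (∀ g ∈ (W a).support, In g) ∧ ∀ d ∈ (W a).darts, sepEdge d.fst d.snd ∉ ω))
    (hpw : Pairwise (fun a b => κ a = κ b → (κ a = true → ∀ e ∈ (W a).edges, e ∉ (W b).edges) ∧
      (κ a = false → ∀ d ∈ (W a).darts, ∀ d' ∈ (W b).darts, sepEdge d.fst d.snd ≠ sepEdge d'.fst d'.snd))) :
    BondConfig.relabel (sym2Equiv φ.toEquiv) ω ∈ hpLooseArms j 3 m R' := by
  obtain ⟨x', y', W', harm', hpw'⟩ := transport_arms_HTP φ ψ hψ ω κ x y W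
    (fun a => ⟨fun h => ((harm a).2.2.1 h).2, fun h => ((harm a).2.2.2 h).2⟩) hpw
  -- coordinate control relative to the base site (integer identities, then real estimates)
  have hI0 : ∀ u : Site 2, |φ u 0 - j| = |u k₀ - p₀ k₀| := fun u => by rw [← hp₀.1]; exact hφ0 u p₀
  have hI1 : ∀ u : Site 2, |φ u 1| = |u k₁ - p₀ k₁| := fun u => by
    rw [show φ u 1 = φ u 1 - φ p₀ 1 by rw [hp₀.2, sub_zero]]; exact hφ1 u p₀
  have hcd : ∀ (u : Site 2) (k : Fin 2), (|u k - p₀ k| : ℝ) ≤ dist (Site.toComplex u) (Site.toComplex p₀) := by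
    intro u k
    fin_cases k
    · exact (coord_le_dist_HTP u p₀).1
    · exact (coord_le_dist_HTP u p₀).2
  have hc0 : ∀ u : Site 2, ((|φ u 0 - j| : ℤ) : ℝ) ≤ dist (Site.toComplex u) z + (r + 2) := by
    intro u
    rw [hI0 u]
    have h2 := hcd u k₀
    push_cast at h2 ⊢
    linarith [dist_triangle (Site.toComplex u) z (Site.toComplex p₀), dist_comm z (Site.toComplex p₀)]
  have hc1 : ∀ u : Site 2, ((|φ u 1| : ℤ) : ℝ) ≤ dist (Site.toComplex u) z + (r + 2) := by
    intro u
    rw [hI1 u]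
    have h2 := hcd u k₁
    push_cast at h2 ⊢
    linarith [dist_triangle (Site.toComplex u) z (Site.toComplex p₀), dist_comm z (Site.toComplex p₀)]
  have hfar : ∀ u : Site 2, dist (Site.toComplex u) z ≤ ((|φ u 0 - j| : ℤ) : ℝ) + ((|φ u 1| : ℤ) : ℝ) + (r + 2) := by
    intro u
    rw [hI0 u, hI1 u]
    have h3 : dist (Site.toComplex u) (Site.toComplex p₀) ≤ ((|u k₀ - p₀ k₀| : ℤ) : ℝ) + ((|u k₁ - p₀ k₁| : ℤ) : ℝ) := by
      have h := dist_le_coord_HTP u p₀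
      push_cast
      fin_cases k₀ <;> fin_cases k₁
      · exact absurd rfl hk
      · simpa using h
      · simpa [add_comm] using h
      · exact absurd rfl hk
    linarith [dist_triangle (Site.toComplex u) (Site.toComplex p₀) z, dist_comm (Site.toComplex p₀) z]
  have hm' : (2 * r + 7 : ℝ) ≤ ((m : ℤ) : ℝ) := by push_cast; exact hm
  refine ufrs_hpLooseArmsOfArms _ j m R' hmR κ x' y' W' hne (fun a => ?_) hpw'
  obtain ⟨hxa, hya, hopen, hdual⟩ := harm a
  cases hκ : κ a
  · -- dual arm
    obtain ⟨hx', hy', hsupp', hd'⟩ := (harm' a).2 hκ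
    obtain ⟨hIn, -⟩ := hdual hκ
    refine ⟨?_, ?_, fun h => Bool.noConfusion h, fun _ => ⟨fun u hu => ?_, hd'⟩⟩
    · rw [hx']
      have h0 := hc0 (x a); have h1 := hc1 (x a)
      obtain ⟨e0, e1⟩ := hψφ (x a)
      have ha0 : ((|φ (x a) 0 - j| : ℤ) : ℝ) ≤ ((m : ℤ) : ℝ) := by linarith
      have ha1 : ((|φ (x a) 1| : ℤ) : ℝ) ≤ ((m : ℤ) : ℝ) - 1 := by linarith
      have ha0' : |φ (x a) 0 - j| ≤ (m : ℤ) := by exact_mod_cast ha0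
      have ha1' : |φ (x a) 1| ≤ (m : ℤ) - 1 := by exact_mod_cast ha1
      have := abs_le.1 ha0'; have := abs_le.1 ha1'
      rw [e0]
      refine ⟨by omega, by omega, ?_⟩
      rcases e1 with e1 | e1 <;> rw [e1] <;> omega
    · rw [hy']
      obtain ⟨e0, e1⟩ := hψφ (y a)
      have hpos : 0 ≤ ψ (y a) 1 := hInh _ (hIn _ (W a).end_mem_support)
      have h := hfar (y a)
      by_contra hcon
      simp only [Z2HalfPlane.Far, not_or, not_le] at hcon
      rw [e0] at hcon
      have h1' : φ (y a) 1 < (R' : ℤ) + 1 := by rcases e1 with e1 | e1 <;> rw [e1] at hcon <;> omega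
      have hpos' : -1 ≤ φ (y a) 1 := by rcases e1 with e1 | e1 <;> rw [e1] at hpos <;> omega
      have hb1 : |φ (y a) 1| < (R' : ℤ) + 1 := abs_lt.2 ⟨by omega, h1'⟩
      have h0 : ((|φ (y a) 0 - j| : ℤ) : ℝ) < ((R' : ℤ) : ℝ) := by exact_mod_cast hcon.1
      have h1 : ((|φ (y a) 1| : ℤ) : ℝ) < ((R' : ℤ) : ℝ) + 1 := by exact_mod_cast hb1
      push_cast at h0 h1 h
      linarith
    · obtain ⟨g, hg, rfl⟩ := hsupp' u hu
      have := hInh g (hIn g hg); omega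
  · -- open arm
    obtain ⟨hx', hy', hsupp', he'⟩ := (harm' a).1 hκ
    obtain ⟨hVs, -⟩ := hopen hκ
    refine ⟨?_, ?_, fun _ => ⟨fun u hu => ?_, he'⟩, fun h => Bool.noConfusion h⟩
    · rw [hx']
      have h0 := hc0 (x a); have h1 := hc1 (x a)
      have ha0 : ((|φ (x a) 0 - j| : ℤ) : ℝ) ≤ ((m : ℤ) : ℝ) := by linarith
      have ha1 : ((|φ (x a) 1| : ℤ) : ℝ) ≤ ((m : ℤ) : ℝ) := by linarith
      have ha0' : |φ (x a) 0 - j| ≤ (m : ℤ) := by exact_mod_cast ha0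
      have ha1' : |φ (x a) 1| ≤ (m : ℤ) := by exact_mod_cast ha1
      have := abs_le.1 ha0'; have := abs_le.1 ha1'
      exact ⟨by omega, by omega, by omega⟩
    · rw [hy']
      have hpos : 0 ≤ φ (y a) 1 := hVh _ (hVs _ (W a).end_mem_support)
      have h := hfar (y a)
      by_contra hcon
      simp only [Z2HalfPlane.Far, not_or, not_le] at hcon
      have hb1 : |φ (y a) 1| < (R' : ℤ) := abs_lt.2 ⟨by omega, hcon.2⟩
      have h0 : ((|φ (y a) 0 - j| : ℤ) : ℝ) < ((R' : ℤ) : ℝ) := by exact_mod_cast hcon.1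
      have h1 : ((|φ (y a) 1| : ℤ) : ℝ) < ((R' : ℤ) : ℝ) := by exact_mod_cast hb1
      push_cast at h0 h1 h
      linarith
    · obtain ⟨v, hv, rfl⟩ := hsupp' u hu
      exact hVh v (hVs v hv)

end

end Summit.CriticalPhenomena.CardyFormulaZ2.Cruxes.EdgePrecompact.QkzStripBoundaryArm
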